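import Summits.PneNP.PneNP.Theorems.ReslinSizeFromWidthPCDegreeTranslation
import Mathlib.RingTheory.MvPolynomial.Homogeneous
import HarnessLib

/-!
# PneNP / ReslinSizeFromWidth — the `+1` of the PC/`𝔽₂` simulation of Res(⊕) is paid at a resolution step

Helper file for crux `ResLinSizeFromWidth` (stmt-PneNP-18932); companion of
`ReslinSizeFromWidthPCDegree.lean` (PC/`𝔽₂` degree ≤ Res(⊕) rank-width `+ 1`).  The line-by-line
translation `C ↦ ResLinPC.clausePoly C` cannot do better than `+1`: the Res(⊕) resolution step

  `(x₁ = 0) ∨ (x₀ = 0),  (x₂ = 0) ∨ (x₀ = 1)  ⊢  (x₁ = 0) ∨ (x₂ = 0)`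

has premises and conclusion of rank `≤ 2` (two disjuncts each), its translations are
`x₀x₁`, `x₂(1 + x₀)` and `x₁x₂` (`clausePoly_premise₁/₂`, `clausePoly_conclusion`), and `x₁x₂` has
NO PC/`𝔽₂` derivation of degree `≤ 2` from `{x₀x₁, x₂(1+x₀)}` (`not_derivableInDegree_two`), while
it has one of degree `3` (`derivableInDegree_three`: `x₁x₂ = x₂·(x₀x₁) + x₁·(x₂ + x₀x₂) - x₀(x₁x₂ …)`,
precisely `x₁·(x₂ + x₂x₀) + x₂·(x₀x₁) = x₁x₂ + 2x₀x₁x₂ = x₁x₂` over `𝔽₂`).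

The degree-`2` impossibility: every line of a degree-`≤ 2` derivation lies in the `𝔽₂`-span `V` of
`x₀x₁`, `x₂ + x₂x₀` and the Boolean axioms `xᵥ² - xᵥ` — each of these generators is recovered
from its degree-`2` homogeneous component by one linear map `recon` (`x₀x₁ ↦ x₀x₁`,
`x₀x₂ ↦ x₂ + x₀x₂`, `xᵥ² ↦ xᵥ² - xᵥ`, other monomials `↦ 0`), so `p = recon (p₂)` on `V`; hence a
nonzero element of `V` has degree exactly `2`, the product rule can only multiply by constants
inside degree `2`, and `x₁x₂ = recon (x₁x₂) = 0` would follow from `x₁x₂ ∈ V`.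

This is an illustration of where the constant is spent, not a claim about the minimal PC degree of
any CNF (whether `Deg ≤ Width` holds exactly as stated in Gryaznov–Ovcharov–Riazanov 2024, Thm 7,
is not decided here).
-/

noncomputable section

namespace Summit.PneNP.PneNP.Theorems

-- `Summit.PneNP.PneNP` repeats a path component by design (summit = sub-problem); silence the linter.
set_option linter.dupNamespace false

namespace ResLinPC

open MvPolynomial Finset
open Literature.Computability.Complexity Literature.Computability.MetaComplexity
open Literature.Computability.MetaComplexity.MLPC

/-! ### The three lines of the example and their translations -/

/-- The first premise `(x₁ = 0) ∨ (x₀ = 0)`. -/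
def premise₁ : LinClause := {(({1} : Finset ℕ), false), (({0} : Finset ℕ), false)}

/-- The second premise `(x₂ = 0) ∨ (x₀ = 1)`. -/
def premise₂ : LinClause := {(({2} : Finset ℕ), false), (({0} : Finset ℕ), true)}

/-- The resolvent `(x₁ = 0) ∨ (x₂ = 0)` (resolution on the form `x₀`). -/
def conclusion : LinClause := {(({1} : Finset ℕ), false), (({2} : Finset ℕ), false)}

/-- The example is an instance of the Res(⊕) resolution rule: the premises are
`C ∨ (x₀ = 0)` and `D ∨ (x₀ = 1)` with `C ∪ D` the conclusion. -/
theorem example_isResolutionStep :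
    premise₁ = insert (({0} : Finset ℕ), false) {(({1} : Finset ℕ), false)} ∧
    premise₂ = insert (({0} : Finset ℕ), true) {(({2} : Finset ℕ), false)} ∧
    conclusion = {(({1} : Finset ℕ), false)} ∪ {(({2} : Finset ℕ), false)} := by
  refine ⟨?_, ?_, ?_⟩
  · rw [premise₁, Finset.insert_eq, Finset.insert_eq, Finset.union_comm]
  · rw [premise₂, Finset.insert_eq, Finset.insert_eq, Finset.union_comm]
  · rw [conclusion, Finset.insert_eq]

/-- All three lines have rank at most `2`. -/
theorem example_rank_le_two :
    linClauseRank premise₁ ≤ 2 ∧ linClauseRank premise₂ ≤ 2 ∧ linClauseRank conclusion ≤ 2 := by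
  refine ⟨(linClauseRank_le_card _).trans ?_, (linClauseRank_le_card _).trans ?_,
    (linClauseRank_le_card _).trans ?_⟩ <;>
  exact Finset.card_le_two

/-- Value of a singleton linear clause. -/
private theorem eval_singleton_clause (x : ℕ → Bool) (l : LinLit) :
    LinClause.eval x ({l} : LinClause) = l.eval x := by
  rw [← Finset.insert_empty, LinClause.eval_insert, LinClause.eval_empty, Bool.or_false]

/-- Value of a two-literal clause of single-variable equations `(xᵢ = a) ∨ (xⱼ = b)`. -/
private theorem eval_pair_clause (x : ℕ → Bool) (i j : ℕ) (a b : Bool) :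
    LinClause.eval x ({(({i} : Finset ℕ), a), (({j} : Finset ℕ), b)} : LinClause) =
      ((x i == a) || (x j == b)) := by
  rw [LinClause.eval_insert, eval_singleton_clause, LinLit.eval_singleton, LinLit.eval_singleton]

/-- `x_u x_v` as a monomial. -/
private theorem X_mul_X_eq (u v : ℕ) :
    (X u * X v : MvPolynomial ℕ (ZMod 2)) = monomial (Finsupp.single u 1 + Finsupp.single v 1) 1 := by
  rw [X, X, monomial_mul, mul_one]

/-- A product of two distinct variables is multilinear. -/
private theorem ml_X_mul_X {u v : ℕ} (huv : u ≠ v) :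
    ml (ZMod 2) (X u * X v : MvPolynomial ℕ (ZMod 2)) = X u * X v := by
  rw [X_mul_X_eq, ml_monomial, (mlMon_eq_self_iff _).2]
  intro i
  simp only [Finsupp.add_apply, Finsupp.single_apply]
  split_ifs <;> omega

/-- `clausePoly ((x₁ = 0) ∨ (x₀ = 0)) = x₀ x₁`. -/
theorem clausePoly_premise₁ : clausePoly premise₁ = X 0 * X 1 := by
  refine eq_of_eval_boolPoint_eq (ml_clausePoly _) (ml_X_mul_X zero_ne_one) fun x => ?_
  rw [eval_boolPoint_clausePoly, map_mul, eval_X, eval_X, premise₁, eval_pair_clause]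
  simp only [boolPoint]
  cases x 0 <;> cases x 1 <;> decide

/-- `clausePoly ((x₂ = 0) ∨ (x₀ = 1)) = x₂ (1 + x₀)`. -/
theorem clausePoly_premise₂ : clausePoly premise₂ = X 2 * (1 + X 0) := by
  refine eq_of_eval_boolPoint_eq (ml_clausePoly _) ?_ fun x => ?_
  · rw [mul_add, mul_one, map_add, ml_X, ml_X_mul_X (by norm_num)]
  · rw [eval_boolPoint_clausePoly, map_mul, map_add, map_one, eval_X, eval_X, premise₂,
      eval_pair_clause]
    simp only [boolPoint]
    cases x 0 <;> cases x 2 <;> decide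

/-- `clausePoly ((x₁ = 0) ∨ (x₂ = 0)) = x₁ x₂`. -/
theorem clausePoly_conclusion : clausePoly conclusion = X 1 * X 2 := by
  refine eq_of_eval_boolPoint_eq (ml_clausePoly _) (ml_X_mul_X (by norm_num)) fun x => ?_
  rw [eval_boolPoint_clausePoly, map_mul, eval_X, eval_X, conclusion, eval_pair_clause]
  simp only [boolPoint]
  cases x 1 <;> cases x 2 <;> decide

/-! ### Degree three suffices -/

/-- The axioms of the example: the translations of the two premises. -/
def exampleAxioms : Set (MvPolynomial ℕ (ZMod 2)) := {X 0 * X 1, X 2 * (1 + X 0)}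

/-- `x₁ x₂` is derivable from `x₀x₁, x₂(1+x₀)` inside degree `3`:
`x₁x₂ = (x₂(1+x₀))·x₁ + (x₀x₁)·x₂` over `𝔽₂`. -/
theorem derivableInDegree_three : PC.DerivableInDegree exampleAxioms 3 (X 1 * X 2) := by
  have h2 : (2 : MvPolynomial ℕ (ZMod 2)) = 0 := by
    have h := CharP.cast_eq_zero (MvPolynomial ℕ (ZMod 2)) 2
    rwa [Nat.cast_ofNat] at h
  have hid : (X 1 * X 2 : MvPolynomial ℕ (ZMod 2)) =
      X 2 * (1 + X 0) * X 1 + X 0 * X 1 * X 2 := by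
    have : X 2 * (1 + X 0) * X 1 + X 0 * X 1 * X 2 =
        (X 1 * X 2 : MvPolynomial ℕ (ZMod 2)) + 2 * (X 0 * X 1 * X 2) := by ring
    rw [this, h2, zero_mul, add_zero]
  have hdegX : ∀ i : ℕ, (X i : MvPolynomial ℕ (ZMod 2)).totalDegree ≤ 1 := fun i =>
    (totalDegree_X (R := ZMod 2) i).le
  have hA1 : PC.DerivableInDegree exampleAxioms 3 (X 0 * X 1) :=
    .hyp (by simp [exampleAxioms]) ((totalDegree_mul _ _).trans (by
      have := hdegX 0; have := hdegX 1; omega))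
  have h1X0 : ((1 : MvPolynomial ℕ (ZMod 2)) + X 0).totalDegree ≤ 1 :=
    (totalDegree_add _ _).trans (max_le (by rw [totalDegree_one]; exact Nat.zero_le _) (hdegX 0))
  have hA2 : PC.DerivableInDegree exampleAxioms 3 (X 2 * (1 + X 0)) :=
    .hyp (by simp [exampleAxioms]) ((totalDegree_mul _ _).trans (by have := hdegX 2; omega))
  have hB1 : PC.DerivableInDegree exampleAxioms 3 (X 2 * (1 + X 0) * X 1) :=
    .mul (X 1) hA2 ((totalDegree_mul _ _).trans (by
      have := totalDegree_mul (X 2 : MvPolynomial ℕ (ZMod 2)) (1 + X 0)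
      have := hdegX 1; have := hdegX 2; omega))
  have hB2 : PC.DerivableInDegree exampleAxioms 3 (X 0 * X 1 * X 2) :=
    .mul (X 2) hA1 ((totalDegree_mul _ _).trans (by
      have := totalDegree_mul (X 0 : MvPolynomial ℕ (ZMod 2)) (X 1)
      have := hdegX 0; have := hdegX 1; have := hdegX 2; omega))
  rw [hid]
  exact .add hB1 hB2

/-! ### Degree two does not suffice -/

/-- The generators of the space containing every degree-`≤ 2` line: the two axioms and all
Boolean axioms. -/
def lineGens : Set (MvPolynomial ℕ (ZMod 2)) :=
  {X 0 * X 1, X 2 + X 2 * X 0} ∪ Set.range fun v : ℕ => (X v ^ 2 - X v : MvPolynomial ℕ (ZMod 2))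

open Classical in
/-- The reconstruction map on exponent vectors: `x₀x₁ ↦ x₀x₁`, `x₀x₂ ↦ x₂ + x₂x₀`,
`xᵥ² ↦ xᵥ² - xᵥ`, everything else `↦ 0`. -/
def reconMon (s : ℕ →₀ ℕ) : MvPolynomial ℕ (ZMod 2) :=
  if s = Finsupp.single 0 1 + Finsupp.single 1 1 then X 0 * X 1
  else if s = Finsupp.single 0 1 + Finsupp.single 2 1 then X 2 + X 2 * X 0
  else if ∃ v, s = Finsupp.single v 2 then monomial s 1 - ml (ZMod 2) (monomial s 1)
  else 0

/-- The reconstruction as a linear map (defined on the monomial basis). -/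
def recon : MvPolynomial ℕ (ZMod 2) →ₗ[ZMod 2] MvPolynomial ℕ (ZMod 2) :=
  (basisMonomials ℕ (ZMod 2)).constr (ZMod 2) reconMon

/-- `recon` on a monomial. -/
theorem recon_monomial (s : ℕ →₀ ℕ) (a : ZMod 2) : recon (monomial s a) = a • reconMon s := by
  have h1 : recon (monomial s (1 : ZMod 2)) = reconMon s := by
    have := (basisMonomials ℕ (ZMod 2)).constr_basis (ZMod 2) reconMon s
    rwa [coe_basisMonomials] at this
  rw [show monomial s a = a • monomial s (1 : ZMod 2) by rw [smul_monomial, smul_eq_mul, mul_one],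
    map_smul, h1]

/-- `x_v²` as a monomial. -/
private theorem X_sq_eq (v : ℕ) :
    (X v ^ 2 : MvPolynomial ℕ (ZMod 2)) = monomial (Finsupp.single v 2) 1 := by
  rw [X_pow_eq_monomial]

/-- The reduced square: `ml (x_v²) = x_v`. -/
private theorem ml_sq (v : ℕ) : ml (ZMod 2) (monomial (Finsupp.single v 2) (1 : ZMod 2)) = X v := by
  have h : mlMon (Finsupp.single v 2) = Finsupp.single v 1 := by
    ext i
    rw [mlMon_apply, Finsupp.single_apply, Finsupp.single_apply]
    split_ifs <;> rfl
  rw [ml_monomial, h, X]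

/-- A product of two distinct variables is not a square. -/
private theorem single_add_single_ne_single_two (u v w : ℕ) (huv : u ≠ v) :
    Finsupp.single u 1 + Finsupp.single v 1 ≠ (Finsupp.single w 2 : ℕ →₀ ℕ) := by
  intro h
  have := congrArg (fun f => f u) h
  simp only [Finsupp.add_apply, Finsupp.single_apply, if_neg huv.symm] at this
  split_ifs at this <;> omega

/-- `x₀x₁ ≠ x₀x₂` (as exponent vectors). -/
private theorem s01_ne_s02 :
    (Finsupp.single 0 1 + Finsupp.single 1 1 : ℕ →₀ ℕ) ≠ Finsupp.single 0 1 + Finsupp.single 2 1 := by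
  intro h
  have := congrArg (fun f => f 1) h
  simp [Finsupp.add_apply] at this

/-- `x₁x₂ ≠ x₀x₁` (as exponent vectors). -/
private theorem s12_ne_s01 :
    (Finsupp.single 1 1 + Finsupp.single 2 1 : ℕ →₀ ℕ) ≠ Finsupp.single 0 1 + Finsupp.single 1 1 := by
  intro h
  have := congrArg (fun f => f 0) h
  simp [Finsupp.add_apply] at this

/-- `x₁x₂ ≠ x₀x₂` (as exponent vectors). -/
private theorem s12_ne_s02 :
    (Finsupp.single 1 1 + Finsupp.single 2 1 : ℕ →₀ ℕ) ≠ Finsupp.single 0 1 + Finsupp.single 2 1 := by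
  intro h
  have := congrArg (fun f => f 0) h
  simp [Finsupp.add_apply] at this

/-- **Reconstruction on the generators**: every generator equals `recon` of its degree-`2`
homogeneous component. -/
theorem recon_homogeneousComponent_of_mem_lineGens {g : MvPolynomial ℕ (ZMod 2)}
    (hg : g ∈ lineGens) : recon (homogeneousComponent 2 g) = g := by
  rcases hg with hg | ⟨v, rfl⟩
  · rcases hg with rfl | rfl
    · -- x₀x₁
      have hhom : (X 0 * X 1 : MvPolynomial ℕ (ZMod 2)).IsHomogeneous 2 := by
        rw [X_mul_X_eq]
        exact isHomogeneous_monomial _ (by simp)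
      rw [homogeneousComponent_of_mem hhom, if_pos rfl, X_mul_X_eq, recon_monomial, one_smul,
        reconMon, if_pos rfl, X_mul_X_eq]
    · -- x₂ + x₂x₀
      have hhom2 : (X 2 * X 0 : MvPolynomial ℕ (ZMod 2)).IsHomogeneous 2 := by
        rw [X_mul_X_eq]
        exact isHomogeneous_monomial _ (by simp)
      have hhom1 : (X 2 : MvPolynomial ℕ (ZMod 2)).IsHomogeneous 1 := isHomogeneous_X _ _
      rw [map_add, homogeneousComponent_of_mem hhom1, if_neg (by norm_num),
        homogeneousComponent_of_mem hhom2, if_pos rfl, zero_add, X_mul_X_eq,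
        show Finsupp.single 2 1 + Finsupp.single 0 1 = (Finsupp.single 0 1 + Finsupp.single 2 1 :
          ℕ →₀ ℕ) from add_comm _ _, recon_monomial, one_smul, reconMon, if_neg s01_ne_s02.symm,
        if_pos rfl, X_mul_X_eq, add_comm (Finsupp.single 2 1)]
  · -- Boolean axiom
    dsimp only
    have hhom2 : (X v ^ 2 : MvPolynomial ℕ (ZMod 2)).IsHomogeneous 2 := isHomogeneous_X_pow _ _
    have hhom1 : (X v : MvPolynomial ℕ (ZMod 2)).IsHomogeneous 1 := isHomogeneous_X _ _
    rw [map_sub, homogeneousComponent_of_mem hhom2, if_pos rfl, homogeneousComponent_of_mem hhom1,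
      if_neg (by norm_num), sub_zero, X_sq_eq, recon_monomial, one_smul, reconMon,
      if_neg (single_add_single_ne_single_two 0 1 v zero_ne_one).symm,
      if_neg (single_add_single_ne_single_two 0 2 v (by norm_num)).symm, if_pos (⟨v, rfl⟩ : ∃ w, Finsupp.single v 2 = (Finsupp.single w 2 : ℕ →₀ ℕ)), ml_sq]

/-- Hence `recon (p₂) = p` on the whole span of the generators. -/
theorem recon_homogeneousComponent_of_mem_span {p : MvPolynomial ℕ (ZMod 2)}
    (hp : p ∈ Submodule.span (ZMod 2) lineGens) : recon (homogeneousComponent 2 p) = p := by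
  induction hp using Submodule.span_induction with
  | mem g hg => exact recon_homogeneousComponent_of_mem_lineGens hg
  | zero => simp
  | add p q _ _ hp hq => rw [map_add, map_add, hp, hq]
  | smul a p _ hp => rw [map_smul, map_smul, hp]

/-- A nonzero element of the span has degree at least `2`. -/
theorem two_le_totalDegree_of_mem_span {p : MvPolynomial ℕ (ZMod 2)}
    (hp : p ∈ Submodule.span (ZMod 2) lineGens) (hne : p ≠ 0) : 2 ≤ p.totalDegree := by
  by_contra hlt
  rw [not_le] at hlt
  have h0 : homogeneousComponent 2 p = 0 := homogeneousComponent_eq_zero _ _ hlt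
  have := recon_homogeneousComponent_of_mem_span hp
  rw [h0, map_zero] at this
  exact hne this.symm

/-- **Every degree-`≤ 2` line lies in the span of the generators.** -/
theorem mem_span_of_derivableInDegree_two {p : MvPolynomial ℕ (ZMod 2)}
    (h : PC.DerivableInDegree exampleAxioms 2 p) : p ∈ Submodule.span (ZMod 2) lineGens := by
  induction h with
  | hyp hf _ =>
    refine Submodule.subset_span (Or.inl ?_)
    rcases hf with rfl | rfl
    · exact Or.inl rfl
    · refine Or.inr (Set.mem_singleton_iff.2 ?_)
      ring
  | booleanAxiom j _ => exact Submodule.subset_span (Or.inr ⟨j, rfl⟩)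
  | add _ _ ihf ihg => exact Submodule.add_mem _ ihf ihg
  | @mul f h' hf hd ih =>
    by_cases hf0 : f = 0
    · rw [hf0, zero_mul]; exact Submodule.zero_mem _
    by_cases hh0 : h' = 0
    · rw [hh0, mul_zero]; exact Submodule.zero_mem _
    -- the product rule can only multiply by a constant inside degree 2
    have hdeg : (f * h').totalDegree = f.totalDegree + h'.totalDegree :=
      totalDegree_mul_of_isDomain hf0 hh0
    have h2 := two_le_totalDegree_of_mem_span ih hf0
    have hh : h'.totalDegree = 0 := by omega
    rw [totalDegree_eq_zero_iff_eq_C] at hh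
    rw [hh, mul_comm, ← smul_eq_C_mul]
    exact Submodule.smul_mem _ _ ih

/-- **`x₁x₂` is not derivable inside degree `2`** from `x₀x₁` and `x₂(1 + x₀)`: the translation of
the resolution step of the example needs degree `3 = rank + 1`. -/
theorem not_derivableInDegree_two : ¬ PC.DerivableInDegree exampleAxioms 2 (X 1 * X 2) := by
  intro h
  have hmem := mem_span_of_derivableInDegree_two h
  have hrec := recon_homogeneousComponent_of_mem_span hmem
  have hhom : (X 1 * X 2 : MvPolynomial ℕ (ZMod 2)).IsHomogeneous 2 := by
    rw [X_mul_X_eq]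
    exact isHomogeneous_monomial _ (by simp)
  rw [homogeneousComponent_of_mem hhom, if_pos rfl, X_mul_X_eq, recon_monomial, one_smul, reconMon,
    if_neg s12_ne_s01, if_neg s12_ne_s02,
    if_neg (fun ⟨v, hv⟩ => single_add_single_ne_single_two 1 2 v (by norm_num) hv)] at hrec
  exact (monomial_eq_zero.not.2 one_ne_zero) hrec.symm

/-- Summary: the PC/`𝔽₂` degree of the translated resolution step of the example is exactly `3`,
one more than the rank of every line involved. -/
theorem example_degree_eq_rank_succ :
    PC.DerivableInDegree exampleAxioms 3 (clausePoly conclusion) ∧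
    ¬ PC.DerivableInDegree exampleAxioms 2 (clausePoly conclusion) ∧
    exampleAxioms = {clausePoly premise₁, clausePoly premise₂} ∧
    linClauseRank premise₁ ≤ 2 ∧ linClauseRank premise₂ ≤ 2 ∧ linClauseRank conclusion ≤ 2 := by
  rw [clausePoly_conclusion, clausePoly_premise₁, clausePoly_premise₂]
  exact ⟨derivableInDegree_three, not_derivableInDegree_two, rfl, example_rank_le_two⟩

end ResLinPC

end Summit.PneNP.PneNP.Theorems
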